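import Summits.BirchSwinnertonDyer.Rank1Residual.Additive.SignedSelmerLevelBridge
import Summits.BirchSwinnertonDyer.Rank1Residual.Additive.StrictSignedLocalPreimageCard
import Literature.NumberTheory.EllipticCurves.PointDivisibilityProofs
import Mathlib.NumberTheory.Padics.HeightOneSpectrum
import HarnessLib

/-!
# THE BRIDGE over `ℚ` at `E = ℚ_[p]`: **`[H¹_𝓖(ℚ, W[p^m]) : H¹_{𝓚[p ↦ 0]}(ℚ, W[p^m])] = [A₀ : S₀]`**
# for the objects `A₀ = Sel^{loc,∞}(W/ℚ)`, `S₀ = Sel^{−,str}(W/ℚ_0)` of the (C3_η) derivation, with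
# the local hypotheses DISCHARGED for the `p*`-twist of a good supersingular curve (cell
# `b2b-bsdres`, CLASS-CLOSURE lane, class O10 — x1b GEN 38, class lead; file 76 of the series)

HONEST FRAMING (cell `b2b-bsdres`, run/shared/lean/b2b/bsd-rank1-residual/, verbatim in every
file): the goal of the cell is to DELETE the COMBINATION-SHAPED residual classes of the
Birch–Swinnerton-Dyer formula for ALL analytic-rank `≤ 1` elliptic curves over `ℚ` — "full BSD
formula for every rank `≤ 1` curve in class `C`" assembled STRICTLY from published theorems — so
that the rank-`≤ 1` remainder becomes exactly the CONSTRUCTION-SHAPED classes, which are TYPED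
(missing-input `Prop`s), NOT attempted. This is not "finishing BSD". CLASS-CLOSURE lane: prove
what is provable now; shrink each hard class to its core with data; no claim beyond stated classes;
research routes on CONSTRUCTION-SHAPED X12 / O10; census / instrument output = EVIDENCE / conjecture
items, NEVER a Literature fact; `RESIDUAL-MAP.md` marks change only by signed lines. THIS FILE:
TOOL THEOREMS ONLY — no definition, no named Literature fact, no Summits-side fact `def … : Prop`,
no `sorry`, axioms standard; nothing is booked; no label / mark / count / sub-cell moves; (C1_η),
(C2_η-GZ), (C3_η) stay typed as filed (cc-typer-6's pen); O10 stays OPEN / CONSTRUCTION-SHAPED;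
nothing about `BSD(W, p)` of any pair is claimed.

## What (all kernel theorems)

* §1 `forall_fixed_eq_zero_of_localFixedPoints` — the hypothesis `E(Ē)[p^∞]^{Γ_E} = 0` of file 74 in
  X11b's `restrictField` form FOLLOWS from the (htors) of files 49/55/59 ("no `p`-power torsion among
  the points of `E(Ē)` fixed by `(ker κ)_E`", discharged for the twist in file 55): a `Γ_E`-fixed
  `Q ∈ E[p^∞](K̄)` has `ι(Q)` fixed by `(ker κ)_E ≤ Γ_E`.
* §2 `relIndex_selmerGroup_update_eq_relIndex_strictSignedSelmerLayer_rat` — file 74's index transfer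
  for `K = ℚ`, `E = ℚ_[p]`, `v₀ =` the place above `p`, the `ℚ`-algebra maps `ℚ_{v₀} ⇄ ℚ_[p]` supplied
  INSIDE the proof by Mathlib's `Padic.adicCompletionEquiv` (no instance hypothesis), `E(K̄)` divisible
  by `zsmul_geomPoints_surjective_holds`: hypotheses = the tower structure `𝓣`, (htors), `p^m A₀ = 0`.
* §3 `…_of_quadraticTwist_signedPrime` — for the `p*`-TWIST `W` of a globally minimal good `a_p = 0`
  curve `V` (`C • W^{(p*)} = V`, `p ≠ 2`), (htors) is DISCHARGED (file 55
  `eq_zero_of_prime_pow_smul_eq_zero_localFixedPointsOfEmb_kerSubgroup_of_quadraticTwist`) and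
  `p^m A₀ = 0` is replaced by `#A₀ ∣ p^m` (e.g. `m ≥ ord_p f(0)` by file 59
  `finite_localPreimage_and_natCard_eq_of_quadraticTwist_signedPrime`): **the count (C) of the (C3_η)
  derivation, `#(A₀ ⧸ S₀)`, IS the index `[H¹_𝓖 : H¹_{𝓚[p ↦ 0]}]` of two Selmer structures on `W[p^m]`**
  — the left side of files 63, 68–70.

References: [GreenbergLNM1716] §3 pp. 85–90; [Kobayashi2003] Def. 2.1, Prop. 8.7, §9 Thm. 9.3;
[Skinner2020] §2.2; [SilvermanAEC2009] VIII.§2 (divisibility of `E(K̄)`).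
-/

noncomputable section

open scoped Classical

open WeierstrassCurve Literature.NumberTheory.EllipticCurves Literature.NumberTheory.GaloisRepresentations
  NumberField IsDedekindDomain Field
open Literature.NumberTheory.GaloisRepresentations.DiscreteGaloisModule (SelmerStructure)
open Literature.NumberTheory.EllipticCurves.Kobayashi2003
open Summit.BirchSwinnertonDyer.Rank1Residual.X11b.Levels
open Summit.BirchSwinnertonDyer.Rank1Residual.X11b
open scoped ContRepresentation

namespace Summit.BirchSwinnertonDyer.Rank1Residual.Additive.LevelBridge

universe u

/-! ### §1 `E(Ē)[p^∞]^{Γ_E} = 0` from (htors) -/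

section Fixed

variable {K : Type u} [Field K] (W : WeierstrassCurve K) (p : ℕ) [hp : Fact p.Prime]
  (E : Type u) [Field E] [Algebra K E]

omit hp in
/-- **(htors) ⟹ `E[p^∞](K̄)^{Γ_E} = 0` (X11b's `restrictField` form).** If no nonzero `p`-power-torsion
point of `E(Ē)` is fixed by the subgroup `H_E = (Γ_E → Γ_K)⁻¹(H)` (the (htors) hypothesis of files
49/59, for `H = ker κ`: no `p`-torsion in `E(K_∞·E)`), then every `Q ∈ E[p^∞](K̄)` fixed by `Γ_E`
(acting through `resGal E = absGaloisRestrict K E`) is zero: `ι(Q) ∈ E(Ē)` is fixed by `Γ_E ⊇ H_E`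
(`pointsMap_smul`), is `p`-power torsion, hence zero, and `ι` is injective.
[cite: Kobayashi2003, Prop. 8.7 (p. 16)] [cite: GreenbergLNM1716, §2 p. 63] -/
theorem forall_fixed_eq_zero_of_localFixedPoints (H : Subgroup (absoluteGaloisGroup K))
    (htors : ∀ P : localPoints W E, P ∈ localFixedPointsOfEmb (closureEmb (K := K) E) W H →
      (∃ j : ℕ, p ^ j • P = 0) → P = 0)
    (Q : W.geomPrimaryTorsion p)
    (hQ : ∀ σ : absoluteGaloisGroup E,
      GaloisRep.restrictField E (LocBridge.primaryGaloisModule W p) σ Q = Q) : Q = 0 := by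
  have hfix : pointsMap W E (Q : geomPoints W) ∈ localFixedPointsOfEmb (closureEmb (K := K) E) W H := by
    rw [mem_localFixedPointsOfEmb_iff]
    intro τ _
    have h : resGal (K := K) E τ • Q = Q := hQ τ
    have h2 := congrArg (fun R : W.geomPrimaryTorsion p ↦ pointsMap W E (R : geomPoints W)) h
    simp only [Literature.NumberTheory.EllipticCurves.primaryComponent.coe_smul, pointsMap_smul] at h2
    exact h2
  obtain ⟨k, hk⟩ := AddCommGroup.mem_primaryComponent.mp Q.2
  have hzero := htors _ hfix ⟨k, by rw [← map_nsmul, hk, map_zero]⟩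
  apply Subtype.ext
  exact pointsMapOfEmb_injective W (closureEmb (K := K) E) (hzero.trans (map_zero _).symm)

end Fixed

/-! ### §2 Over `ℚ` with `E = ℚ_[p]` -/

section Rat

variable (W : WeierstrassCurve ℚ) [W.IsElliptic] {p : ℕ} [hp : Fact p.Prime] (κ : ZpExtension ℚ p)
  (m : ℕ)

/-- **THE BRIDGE over `ℚ` at `E = ℚ_[p]`.** With `v₀` the place of `ℚ` above `p`
(`(primesEquiv).symm p`; `ℚ_{v₀} ⇄ ℚ_[p]` by Mathlib's `Padic.adicCompletionEquiv`), `𝓣` a tower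
structure on `W[p^m]` at level `m`, `A₀ = Sel^{loc,∞}(W/ℚ)` (files 42–59: `(Sel_{p^∞}(W/ℚ_∞) ⊓ ⨅_σ
conj_σ⁻¹ Kummer_∞(⨆_n E^{−,str}(ℚ_n·ℚ_p))) ∘ h_0`), `S₀ = Sel^{−,str}(W/ℚ_0)`, under (htors) "no
`p`-power torsion in `W(ℚ_∞·ℚ_p)`" and `p^m A₀ = 0`:
**`[H¹_{𝓣[v₀ ↦ 𝓣_{v₀} ⊓ loc_{v₀}(Ψ_m⁻¹A₀)]} : H¹_{𝓚[v₀ ↦ 0]}] = [A₀ : S₀]`** (file 74;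
`E(K̄)` divisible by `zsmul_geomPoints_surjective_holds`). [cite: GreenbergLNM1716, §3 pp. 85–90]
[cite: Kobayashi2003, Def. 2.1 (p. 5), §9 Thm. 9.3 (p. 26)] -/
theorem relIndex_selmerGroup_update_eq_relIndex_strictSignedSelmerLayer_rat
    (htors : ∀ P : localPoints W ℚ_[p], P ∈ localFixedPointsOfEmb (closureEmb (K := ℚ) ℚ_[p]) W
      κ.kerSubgroup → (∃ j : ℕ, p ^ j • P = 0) → P = 0)
    (𝓣 : SelmerStructure (W.torsionGaloisModule ((p ^ m : ℕ) : ℤ)))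
    (h𝓣fin : ∀ v : HeightOneSpectrum (𝓞 ℚ), 𝓣 (Sum.inr v) =
      (W.localTowerKer κ (v.adicCompletion ℚ) 0).comap
        ((resH1Hom (subgroupIncl (localSubgroup (κ.layerSubgroup 0) (v.adicCompletion ℚ)))
          (AddMonoidHom.id (localPoints W (v.adicCompletion ℚ))) (fun _ _ ↦ rfl)).comp
          (galoisCohomology.map
            (W.torsionPointsMapIntertwining ((p ^ m : ℕ) : ℤ) (v.adicCompletion ℚ)) 1)))
    (h𝓣inf : ∀ w : InfinitePlace ℚ, 𝓣 (Sum.inl w) = W.kummerSelmerStructure ((p ^ m : ℕ) : ℤ) (Sum.inl w))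
    (hA₀ : ∀ z ∈ (W.selmerInfty κ ⊓ ⨅ σ : absoluteGaloisGroup ℚ,
        (localKummerOverOfEmb W p κ.kerSubgroup (closureEmb (K := ℚ) ℚ_[p])
          (⨆ n, strictSignedLocalPoints κ ℚ_[p] W (-1) n)).comap
            (W.conjH1 p κ.kerSubgroup σ)).comap (W.layerToInfty κ 0), p ^ m • z = 0) :
    (SelmerStructure.selmerGroup (Function.update (W.kummerSelmerStructure ((p ^ m : ℕ) : ℤ))
        (Sum.inr ((Rat.HeightOneSpectrum.primesEquiv (R := 𝓞 ℚ)).symm ⟨p, hp.out⟩)) ⊥)).relIndex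
      (SelmerStructure.selmerGroup (Function.update 𝓣
        (Sum.inr ((Rat.HeightOneSpectrum.primesEquiv (R := 𝓞 ℚ)).symm ⟨p, hp.out⟩))
        (𝓣 (Sum.inr ((Rat.HeightOneSpectrum.primesEquiv (R := 𝓞 ℚ)).symm ⟨p, hp.out⟩)) ⊓
        ((((W.selmerInfty κ ⊓ ⨅ σ : absoluteGaloisGroup ℚ,
            (localKummerOverOfEmb W p κ.kerSubgroup (closureEmb (K := ℚ) ℚ_[p])
              (⨆ n, strictSignedLocalPoints κ ℚ_[p] W (-1) n)).comap
                (W.conjH1 p κ.kerSubgroup σ)).comap (W.layerToInfty κ 0)).comap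
          ((resH1Hom (subgroupIncl (κ.layerSubgroup 0)) (AddMonoidHom.id (geomPrimaryTorsion W p))
            (fun _ _ ↦ rfl)).comp (galoisCohomology.map (primaryInclusion W p m) 1))).map
          (galoisCohomology.localization (W.torsionGaloisModule ((p ^ m : ℕ) : ℤ))
            (Sum.inr ((Rat.HeightOneSpectrum.primesEquiv (R := 𝓞 ℚ)).symm ⟨p, hp.out⟩)) 1))))) =
      (strictSignedSelmerLayer W κ ℚ_[p] (-1) 0).relIndex
        ((W.selmerInfty κ ⊓ ⨅ σ : absoluteGaloisGroup ℚ,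
          (localKummerOverOfEmb W p κ.kerSubgroup (closureEmb (K := ℚ) ℚ_[p])
            (⨆ n, strictSignedLocalPoints κ ℚ_[p] W (-1) n)).comap
              (W.conjH1 p κ.kerSubgroup σ)).comap (W.layerToInfty κ 0)) := by
  set v : HeightOneSpectrum (𝓞 ℚ) := (Rat.HeightOneSpectrum.primesEquiv (R := 𝓞 ℚ)).symm ⟨p, hp.out⟩
    with hv
  let e : ℚ_[p] ≃A[ℚ] v.adicCompletion ℚ := Padic.adicCompletionEquiv (𝓞 ℚ) ⟨p, hp.out⟩
  letI : Algebra (v.adicCompletion ℚ) ℚ_[p] :=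
    ((e.symm : v.adicCompletion ℚ ≃A[ℚ] ℚ_[p]) : v.adicCompletion ℚ →ₐ[ℚ] ℚ_[p]).toRingHom.toAlgebra
  haveI : IsScalarTower ℚ (v.adicCompletion ℚ) ℚ_[p] :=
    IsScalarTower.of_algebraMap_eq fun q ↦
      (((e.symm : v.adicCompletion ℚ ≃A[ℚ] ℚ_[p]) : v.adicCompletion ℚ →ₐ[ℚ] ℚ_[p]).commutes q).symm
  letI : Algebra ℚ_[p] (v.adicCompletion ℚ) :=
    ((e : ℚ_[p] ≃A[ℚ] v.adicCompletion ℚ) : ℚ_[p] →ₐ[ℚ] v.adicCompletion ℚ).toRingHom.toAlgebra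
  haveI : IsScalarTower ℚ ℚ_[p] (v.adicCompletion ℚ) :=
    IsScalarTower.of_algebraMap_eq fun q ↦
      (((e : ℚ_[p] ≃A[ℚ] v.adicCompletion ℚ) : ℚ_[p] →ₐ[ℚ] v.adicCompletion ℚ).commutes q).symm
  exact relIndex_selmerGroup_update_eq_relIndex_strictSignedSelmerLayer W p κ m v ℚ_[p]
    (zsmul_geomPoints_surjective_holds W)
    (forall_fixed_eq_zero_of_localFixedPoints W p ℚ_[p] κ.kerSubgroup htors) 𝓣 h𝓣fin h𝓣inf hA₀

/-! ### §3 For the `p*`-twist of a good supersingular curve: (htors) discharged, `#A₀ ∣ p^m` -/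

/-- **THE BRIDGE for the `p*`-TWIST `W` of a globally minimal good `a_p = 0` curve `V`**
(`C • W^{((−1)^{p/2} p)} = V`, `V` good at `p` with `a_p(V) = 0`, `p ≠ 2`): (htors) is DISCHARGED
(file 55 `eq_zero_of_prime_pow_smul_eq_zero_localFixedPointsOfEmb_kerSubgroup_of_quadraticTwist`:
`W(ℚ_∞·ℚ_p)[p^∞] = 0`), and `p^m A₀ = 0` follows from `#A₀ ∣ p^m` (file 59: `#A₀ = p^{ord_p f(0)}` from the
strict signed dual datum, so any `m ≥ ord_p f(0)` will do).  Remaining hypotheses: the tower structure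
`𝓣` on `W[p^m]` (a description, files 72/75) and `#A₀ ∣ p^m`.  Conclusion:
**`[H¹_{𝓣[v₀ ↦ 𝓣_{v₀} ⊓ loc_{v₀}(Ψ_m⁻¹A₀)]}(ℚ, W[p^m]) : H¹_{𝓚[v₀ ↦ 0]}(ℚ, W[p^m])] = [A₀ : S₀]`** — the
count (C) of the (C3_η) derivation IS the index the finite-level count (files 63, 68–70) computes.
Nothing about (C1_η), (C2_η-GZ), (C3_η) or `BSD(W, p)` is claimed. [cite: Kobayashi2003, Prop. 8.7 (p. 16), Def. 2.1 (p. 5), Thm. 9.3 (p. 26)]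
[cite: GreenbergLNM1716, §3 pp. 85–90 and §4 Thm. 4.1 (p. 102)] -/
theorem relIndex_selmerGroup_update_eq_relIndex_strictSignedSelmerLayer_of_quadraticTwist_signedPrime
    (hp2 : p ≠ 2) (C : VariableChange ℚ) (V : WeierstrassCurve ℚ) [V.IsElliptic] [V.IsGloballyMinimal]
    (hCV : C • W.quadraticTwist ((-1) ^ (p / 2) * p) = V)
    (hgood : V.HasGoodReductionAtPrime p) (hap : V.frobeniusTrace p = 0)
    (𝓣 : SelmerStructure (W.torsionGaloisModule ((p ^ m : ℕ) : ℤ)))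
    (h𝓣fin : ∀ v : HeightOneSpectrum (𝓞 ℚ), 𝓣 (Sum.inr v) =
      (W.localTowerKer κ (v.adicCompletion ℚ) 0).comap
        ((resH1Hom (subgroupIncl (localSubgroup (κ.layerSubgroup 0) (v.adicCompletion ℚ)))
          (AddMonoidHom.id (localPoints W (v.adicCompletion ℚ))) (fun _ _ ↦ rfl)).comp
          (galoisCohomology.map
            (W.torsionPointsMapIntertwining ((p ^ m : ℕ) : ℤ) (v.adicCompletion ℚ)) 1)))
    (h𝓣inf : ∀ w : InfinitePlace ℚ, 𝓣 (Sum.inl w) = W.kummerSelmerStructure ((p ^ m : ℕ) : ℤ) (Sum.inl w))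
    (hcard : Nat.card ↥((W.selmerInfty κ ⊓ ⨅ σ : absoluteGaloisGroup ℚ,
        (localKummerOverOfEmb W p κ.kerSubgroup (closureEmb (K := ℚ) ℚ_[p])
          (⨆ n, strictSignedLocalPoints κ ℚ_[p] W (-1) n)).comap
            (W.conjH1 p κ.kerSubgroup σ)).comap (W.layerToInfty κ 0)) ∣ p ^ m) :
    (SelmerStructure.selmerGroup (Function.update (W.kummerSelmerStructure ((p ^ m : ℕ) : ℤ))
        (Sum.inr ((Rat.HeightOneSpectrum.primesEquiv (R := 𝓞 ℚ)).symm ⟨p, hp.out⟩)) ⊥)).relIndex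
      (SelmerStructure.selmerGroup (Function.update 𝓣
        (Sum.inr ((Rat.HeightOneSpectrum.primesEquiv (R := 𝓞 ℚ)).symm ⟨p, hp.out⟩))
        (𝓣 (Sum.inr ((Rat.HeightOneSpectrum.primesEquiv (R := 𝓞 ℚ)).symm ⟨p, hp.out⟩)) ⊓
        ((((W.selmerInfty κ ⊓ ⨅ σ : absoluteGaloisGroup ℚ,
            (localKummerOverOfEmb W p κ.kerSubgroup (closureEmb (K := ℚ) ℚ_[p])
              (⨆ n, strictSignedLocalPoints κ ℚ_[p] W (-1) n)).comap
                (W.conjH1 p κ.kerSubgroup σ)).comap (W.layerToInfty κ 0)).comap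
          ((resH1Hom (subgroupIncl (κ.layerSubgroup 0)) (AddMonoidHom.id (geomPrimaryTorsion W p))
            (fun _ _ ↦ rfl)).comp (galoisCohomology.map (primaryInclusion W p m) 1))).map
          (galoisCohomology.localization (W.torsionGaloisModule ((p ^ m : ℕ) : ℤ))
            (Sum.inr ((Rat.HeightOneSpectrum.primesEquiv (R := 𝓞 ℚ)).symm ⟨p, hp.out⟩)) 1))))) =
      (strictSignedSelmerLayer W κ ℚ_[p] (-1) 0).relIndex
        ((W.selmerInfty κ ⊓ ⨅ σ : absoluteGaloisGroup ℚ,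
          (localKummerOverOfEmb W p κ.kerSubgroup (closureEmb (K := ℚ) ℚ_[p])
            (⨆ n, strictSignedLocalPoints κ ℚ_[p] W (-1) n)).comap
              (W.conjH1 p κ.kerSubgroup σ)).comap (W.layerToInfty κ 0)) := by
  obtain ⟨M, hΔ, hA, hVM⟩ := exists_goodSupersingularPadicModel hp2 V hgood hap
  have hc := sq_ne_neg_one_pow_mul_prime hp.out (p / 2)
  refine relIndex_selmerGroup_update_eq_relIndex_strictSignedSelmerLayer_rat W κ m
    (eq_zero_of_prime_pow_smul_eq_zero_localFixedPointsOfEmb_kerSubgroup_of_quadraticTwist κ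
      (closureEmb (K := ℚ) ℚ_[p]) hp2 W hc C hCV M hΔ hA hVM) 𝓣 h𝓣fin h𝓣inf ?_
  intro z hz
  have h := addOrderOf_dvd_iff_nsmul_eq_zero.mp ((addOrderOf_dvd_natCard (⟨z, hz⟩ : ↥((W.selmerInfty κ ⊓
    ⨅ σ : absoluteGaloisGroup ℚ, (localKummerOverOfEmb W p κ.kerSubgroup (closureEmb (K := ℚ) ℚ_[p])
      (⨆ n, strictSignedLocalPoints κ ℚ_[p] W (-1) n)).comap (W.conjH1 p κ.kerSubgroup σ)).comap
        (W.layerToInfty κ 0)))).trans hcard)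
  exact congrArg Subtype.val h

end Rat

end Summit.BirchSwinnertonDyer.Rank1Residual.Additive.LevelBridge

end
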